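import Summits.QuantumAdvantage.QuantumAdvantage.Theorems.SosSandwichPseudoBoundedAASymmetricCornerSharpPrep
import Literature.Computability.QuantumComplexity.PseudoBounded
import HarnessLib

/-!
# Crux `PseudoBoundedAA` (stmt-QuantumAdvantage-15237) / `AAConj` (10748) — the SYMMETRIC CORNER with the SHARP
# exponent, part 2/2: `maxInf ≥ Var²/(64 d²)` for weight-symmetric bounded polynomials of degree `≤ d`

`Theorems/SosSandwichPseudoBoundedAASymmetricCorner.lean` proves the Aaronson–Ambainis conjecture on the symmetric corner
in the shape `∃ i, Var[p]²/d⁴ ≤ Inf_i[p]` (Markov's inequality `|P'| ≤ 2d²‖P‖/n` on the symmetrised polynomial).  Here the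
`d`-exponent is brought down to the conjectured optimum `2` — the card's sharp prediction `(c, exponent of T) = (2, 2)`,
attained on this very corner by the Chebyshev profiles `p(x) = (1 + T_d((2|x| − n)/n))/2`, `d ≍ √n`
(`Var ≍ 1`, every `Inf_i ≍ 1/n ≍ 1/d²`), and in the `Var`-exponent by `p = |x|/n` (`Inf_i = 16·Var²`).

THE ARGUMENT (item (3) of the g5 repair census `CALIBRATION-17872-l1Family-g5.md`, "d⁴ → d² via Bernstein", done
instead with V. A. Markov's COEFFICIENT inequality, which the tree holds).  Let `p` be `[0,1]`-valued on `{0,1}^n`,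
weight-symmetric, of degree `≤ d`, and `n ≥ 192 d²`.  By Minsky–Papert `p(x) = P(|x|)` with `deg P ≤ d`, `|P| ≤ 1` at the
integers of `[0, n]`, hence (Ehlich–Zeller mesh lemma, `4d² ≤ n`) `|P| ≤ 2` on `[0, n]`.  Rescale: `Q(t) = P(n(1+t)/2)` has
`|Q| ≤ 2` on `[-1, 1]`, so V. A. Markov's inequality (Rivlin 1974, Sect. 2.7 (2.44)–(2.45), tree
`MarkovCoefficientInequality.abs_coeff_le_mul_max_abs_coeff_T`) bounds its power-basis coefficients:
`|b_j| ≤ 2·max(|t_j^{(d)}|, |t_j^{(d-1)}|) ≤ 2(2d)^j/j!` (`j ≥ 1`).  On the cube `p(x) = Q(t(x))` with the CENTRED RESCALED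
WEIGHT `t(x) = (2|x| − n)/n = −(1/n) Σ_i χ_{{i}}(x)`, a Fourier-degree-`1` function with `E t² = 1/n`; Bonami's lemma
(O'Donnell 2014 Thm 9.21, tree `IsLevelLE.bonami_even_moment`) gives `E t^{2j} ≤ (2j−1)^j/n^j`.  Cauchy–Schwarz with the
weights `4^{-j}` and `j^j/j! ≤ e^j ≤ 3^j`:
`Var[p] ≤ E(p − b_0)² = E(Σ_{j=1}^d b_j t^j)² ≤ (1/3) Σ_j 4^j b_j² E t^{2j} ≤ (4/3) Σ_j (96 d²/n)^j ≤ 256 d²/n`.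
So `Var·n ≤ 256 d²` when `n ≥ 192 d²`, and trivially (`Var ≤ 1`) when `n < 192 d²`; with Poincaré–pigeonhole
`maxInf ≥ 4Var/n` this is **`∃ i, Var[p]²/(64 d²) ≤ Inf_i[p]`**.

* §1–§2 (part 1, `Theorems/SosSandwichPseudoBoundedAASymmetricCornerSharpPrep.lean`): the centred rescaled weight (Walsh
  expansion, level `1`, `E t² = 1/n`, Bonami moments) and the rescaled univariate polynomial (V. A. Markov coefficient bound);
* §3 (here) `boolVariance_le_of_symmetric_sharp` — `Var[p] ≤ 256 d²/n` for `n ≥ 192 d²`; `boolVariance_mul_card_le_of_symmetric` — `Var[p]·n ≤ 256 d²`; `exists_influence_ge_of_symmetric_sharp` —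
  `∃ i, Var²/(64d²) ≤ Inf_i`; the route-decl shapes `aaConj_symmetricCorner_sharp` (`(c, C) = (2, 1/64)`) and
  `pseudoBoundedAA_symmetricCorner_sharp` (`(c, C) = (2, 1/256)`, pseudo-bounded of order `T` ⟹ degree `≤ 2T`).

Honest label: a classical corner (univariate approximation theory) of an open conjecture, now with both exponents optimal
on the corner; no registered stub, crux or summit is closed.  Sources: Rivlin 1974 Sect. 2.7; O'Donnell 2014 Thm 9.21,
§2.3; Beals et al. 2001 Lemma 3.2; Ehlich–Zeller 1964 / Korneichuk 1991 Thm 3.5.8; Aaronson–Ambainis arXiv:0911.0996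
Conj. 6; Kaniewski–Lee–de Wolf arXiv:1411.7280 Def. 7.
-/

-- D-0017: single-conjunct summit ⇒ the duplicate `QuantumAdvantage.QuantumAdvantage` is mandated.
set_option linter.dupNamespace false

noncomputable section

open Finset
open Literature.Computability.QuantumComplexity

namespace Summit.QuantumAdvantage.QuantumAdvantage.Theorems.SosSandwich.SymmetricCorner

variable {N : ℕ}

/-! ### §3 The sharp variance bound and the symmetric corner with exponent `d²` -/

/-- **`Var[p] ≤ 256 d²/n` for `n ≥ 192 d²`** — the sharp variance bound for a weight-symmetric `[0,1]`-bounded `p` of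
degree `≤ d` (V. A. Markov coefficients of the rescaled symmetrisation, Bonami moments of the centred weight,
Cauchy–Schwarz with weights `4^{-j}`). [cite: Rivlin1974, Sect. 2.7 Remark 2 (2.44)-(2.45)] [cite: ODonnell2014, Thm. 9.21]
[cite: BealsEtAl2001, Lemma 3.2] -/
theorem boolVariance_le_of_symmetric_sharp {d : ℕ} (p : MvPolynomial (Fin N) ℝ) (hdeg : p.totalDegree ≤ d)
    (hsym : ∀ x x' : Fin N → Bool,
      (Finset.univ.filter fun k => x k = true).card = (Finset.univ.filter fun k => x' k = true).card →
        evalBool p x = evalBool p x')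
    (hb : ∀ x, 0 ≤ evalBool p x ∧ evalBool p x ≤ 1) (hn : 192 * d ^ 2 ≤ N) (hN : 0 < N) :
    boolVariance p ≤ 256 * (d : ℝ) ^ 2 / N := by
  set P := symPoly N p with hPdef
  have hPdeg : P.natDegree ≤ d := (natDegree_symPoly_le p).trans hdeg
  have hN0 : (0 : ℝ) < (N : ℝ) := by exact_mod_cast hN
  have hNne : (N : ℝ) ≠ 0 := hN0.ne'
  have hint : ∀ k : ℕ, k ≤ N → |P.eval (k : ℝ)| ≤ 1 := by
    intro k hk
    have h := symPoly_eval_nat_mem p hsym hb hk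
    rw [abs_le]; constructor <;> linarith [h.1, h.2]
  have h4 : 4 * d ^ 2 ≤ N := le_trans (Nat.mul_le_mul_right _ (by norm_num)) hn
  have hM2 := abs_symPoly_le_two P hPdeg h4 hN hint
  -- the rescaled polynomial and its coefficients
  set Q := P.comp (Polynomial.C ((N : ℝ) / 2) * (Polynomial.X + Polynomial.C 1)) with hQdef
  have hQdeg : Q.natDegree ≤ d := (natDegree_rescale_le P _).trans hPdeg
  have hcoef : ∀ j, 1 ≤ j → |Q.coeff j| ≤ 2 * ((2 * (d : ℝ)) ^ j / (j.factorial : ℝ)) :=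
    fun j hj => abs_coeff_rescale_le hPdeg hN hM2 hj
  -- the centred rescaled weight, pointwise
  set t : (Fin N → Bool) → ℝ := fun x =>
    (2 * (((Finset.univ.filter fun k => x k = true).card : ℕ) : ℝ) - N) / N with htdef
  -- `p(x) = Q(t(x)) = Σ_{j ≤ d} b_j t(x)^j`
  have heval : ∀ x : Fin N → Bool, evalBool p x = ∑ j ∈ Finset.range (d + 1), Q.coeff j * t x ^ j := by
    intro x
    rw [← Polynomial.eval_eq_sum_range' (Nat.lt_succ_of_le hQdeg), hQdef, eval_rescale, htdef]
    rw [← symPoly_eval_weight p hsym x]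
    congr 1
    field_simp
    ring
  -- deviation from the constant coefficient
  have hdev : ∀ x : Fin N → Bool, evalBool p x - Q.coeff 0 =
      ∑ i ∈ Finset.range d, ((1 : ℝ) / 2) ^ (i + 1) * ((2 : ℝ) ^ (i + 1) * Q.coeff (i + 1) * t x ^ (i + 1)) := by
    intro x
    rw [heval x, Finset.sum_range_succ', pow_zero, mul_one, add_sub_cancel_right]
    refine Finset.sum_congr rfl fun i _ => ?_
    have : ((1 : ℝ) / 2) ^ (i + 1) * (2 : ℝ) ^ (i + 1) = 1 := by
      rw [← mul_pow]; norm_num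
    calc Q.coeff (i + 1) * t x ^ (i + 1) = (((1 : ℝ) / 2) ^ (i + 1) * (2 : ℝ) ^ (i + 1)) *
          (Q.coeff (i + 1) * t x ^ (i + 1)) := by rw [this, one_mul]
      _ = _ := by ring
  -- pointwise Cauchy–Schwarz
  have hpt : ∀ x : Fin N → Bool, (evalBool p x - Q.coeff 0) ^ 2 ≤
      (1 / 3 : ℝ) * ∑ i ∈ Finset.range d, (4 : ℝ) ^ (i + 1) * Q.coeff (i + 1) ^ 2 * t x ^ (2 * (i + 1)) := by
    intro x
    rw [hdev x]
    refine (Finset.sum_mul_sq_le_sq_mul_sq _ _ _).trans ?_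
    have hsq : ∀ i ∈ Finset.range d, ((2 : ℝ) ^ (i + 1) * Q.coeff (i + 1) * t x ^ (i + 1)) ^ 2 =
        (4 : ℝ) ^ (i + 1) * Q.coeff (i + 1) ^ 2 * t x ^ (2 * (i + 1)) := by
      intro i _
      rw [mul_pow, mul_pow, ← pow_mul, ← pow_mul, mul_comm (i + 1) 2, pow_mul (2 : ℝ) 2 (i + 1)]
      norm_num
    rw [Finset.sum_congr rfl hsq]
    exact mul_le_mul_of_nonneg_right (sum_quarter_pow_succ_le d)
      (Finset.sum_nonneg fun i _ => by rw [pow_mul]; positivity)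
  -- each averaged term: `4^j b_j² E t^{2j} ≤ 4·(96 d²/n)^j`
  have hterm : ∀ i ∈ Finset.range d,
      (4 : ℝ) ^ (i + 1) * Q.coeff (i + 1) ^ 2 * boolAvg (fun x => t x ^ (2 * (i + 1))) ≤
        4 * (96 * (d : ℝ) ^ 2 / N) ^ (i + 1) := by
    intro i _
    set j := i + 1 with hj
    have hj1 : 1 ≤ j := by omega
    have hmom : boolAvg (fun x => t x ^ (2 * j)) ≤ (2 * j - 1 : ℝ) ^ j / (N : ℝ) ^ j :=
      boolAvg_centredWeight_pow_le hN hj1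
    have hmom0 : 0 ≤ boolAvg (fun x => t x ^ (2 * j)) :=
      boolAvg_nonneg fun x => by rw [pow_mul]; positivity
    have hb2 : Q.coeff j ^ 2 ≤ (2 * ((2 * (d : ℝ)) ^ j / (j.factorial : ℝ))) ^ 2 := by
      calc Q.coeff j ^ 2 = |Q.coeff j| ^ 2 := (sq_abs _).symm
        _ ≤ _ := pow_le_pow_left₀ (abs_nonneg _) (hcoef j hj1) 2
    have hfac : (0 : ℝ) < (j.factorial : ℝ) := by exact_mod_cast Nat.factorial_pos j
    have hjR : (1 : ℝ) ≤ j := by exact_mod_cast hj1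
    -- `(2j-1)^j ≤ 2^j j^j ≤ 2^j 3^j j!` and `1/j! ≤ 1`
    have h2j : (2 * j - 1 : ℝ) ^ j ≤ (6 : ℝ) ^ j * (j.factorial : ℝ) := by
      calc (2 * j - 1 : ℝ) ^ j ≤ (2 * (j : ℝ)) ^ j :=
            pow_le_pow_left₀ (by linarith) (by linarith) j
        _ = 2 ^ j * (j : ℝ) ^ j := mul_pow _ _ _
        _ ≤ 2 ^ j * (3 ^ j * (j.factorial : ℝ)) :=
            mul_le_mul_of_nonneg_left (pow_self_le_three_pow_mul_factorial j) (by positivity)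
        _ = (6 : ℝ) ^ j * (j.factorial : ℝ) := by
            rw [← mul_assoc, ← mul_pow]; norm_num
    have hfac1 : (1 : ℝ) ≤ (j.factorial : ℝ) := by exact_mod_cast Nat.succ_le_of_lt (Nat.factorial_pos j)
    calc (4 : ℝ) ^ j * Q.coeff j ^ 2 * boolAvg (fun x => t x ^ (2 * j))
        ≤ (4 : ℝ) ^ j * (2 * ((2 * (d : ℝ)) ^ j / (j.factorial : ℝ))) ^ 2 * ((2 * j - 1 : ℝ) ^ j / (N : ℝ) ^ j) := by
          gcongr
      _ = 4 * ((16 : ℝ) ^ j * (d : ℝ) ^ (2 * j) / (N : ℝ) ^ j) *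
            ((2 * j - 1 : ℝ) ^ j / ((j.factorial : ℝ) * (j.factorial : ℝ))) := by
          have h16 : (16 : ℝ) ^ j = 4 ^ j * (2 ^ j * 2 ^ j) := by
            rw [← mul_pow, ← mul_pow]; norm_num
          have hd2 : (d : ℝ) ^ (2 * j) = (d : ℝ) ^ j * (d : ℝ) ^ j := by rw [two_mul, pow_add]
          rw [h16, hd2, mul_pow]
          field_simp
          ring
      _ ≤ 4 * ((16 : ℝ) ^ j * (d : ℝ) ^ (2 * j) / (N : ℝ) ^ j) * ((6 : ℝ) ^ j) := by
          refine mul_le_mul_of_nonneg_left ?_ (by positivity)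
          rw [div_le_iff₀ (by positivity)]
          calc (2 * j - 1 : ℝ) ^ j ≤ (6 : ℝ) ^ j * (j.factorial : ℝ) := h2j
            _ = (6 : ℝ) ^ j * ((j.factorial : ℝ) * 1) := by rw [mul_one]
            _ ≤ (6 : ℝ) ^ j * ((j.factorial : ℝ) * (j.factorial : ℝ)) := by gcongr
      _ = 4 * (96 * (d : ℝ) ^ 2 / N) ^ j := by
          rw [div_pow, mul_pow, ← pow_mul, show (96 : ℝ) = 16 * 6 by norm_num, mul_pow]
          ring
  -- the geometric sum: `ρ = 96 d²/n ≤ 1/2`, `Σ_{j=1}^d ρ^j ≤ 2ρ`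
  have hρ : 96 * (d : ℝ) ^ 2 / N ≤ 1 / 2 := by
    rw [div_le_iff₀ hN0]
    have : (192 : ℝ) * (d : ℝ) ^ 2 ≤ N := by exact_mod_cast hn
    linarith
  have hρ0 : 0 ≤ 96 * (d : ℝ) ^ 2 / N := by positivity
  have hgeom : ∀ m : ℕ, ∑ i ∈ Finset.range m, (96 * (d : ℝ) ^ 2 / N) ^ (i + 1) ≤ 2 * (96 * (d : ℝ) ^ 2 / N) := by
    intro m
    set ρ := 96 * (d : ℝ) ^ 2 / N with hρdef
    have key : ∀ m : ℕ, ∑ i ∈ Finset.range m, ρ ^ (i + 1) = ρ * (1 - ρ ^ m) / (1 - ρ) := by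
      intro m
      have h1 : (1 : ℝ) - ρ ≠ 0 := by linarith
      induction m with
      | zero => simp
      | succ m ih =>
        rw [Finset.sum_range_succ, ih]
        field_simp
        ring
    rw [key m]
    rw [div_le_iff₀ (by linarith)]
    have : 0 ≤ ρ ^ m := by positivity
    nlinarith
  -- assemble
  have hsumavg : boolAvg (fun x => (evalBool p x - Q.coeff 0) ^ 2) ≤
      (1 / 3 : ℝ) * ∑ i ∈ Finset.range d, (4 : ℝ) ^ (i + 1) * Q.coeff (i + 1) ^ 2 *
        boolAvg (fun x => t x ^ (2 * (i + 1))) := by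
    unfold boolAvg
    calc (∑ x : Fin N → Bool, (evalBool p x - Q.coeff 0) ^ 2) / 2 ^ N
        ≤ (∑ x : Fin N → Bool, (1 / 3 : ℝ) * ∑ i ∈ Finset.range d,
            (4 : ℝ) ^ (i + 1) * Q.coeff (i + 1) ^ 2 * t x ^ (2 * (i + 1))) / 2 ^ N :=
          div_le_div_of_nonneg_right (Finset.sum_le_sum fun x _ => hpt x) (by positivity)
      _ = (1 / 3 : ℝ) * ∑ i ∈ Finset.range d, (4 : ℝ) ^ (i + 1) * Q.coeff (i + 1) ^ 2 *
            ((∑ x : Fin N → Bool, t x ^ (2 * (i + 1))) / 2 ^ N) := by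
          rw [← Finset.mul_sum, Finset.sum_comm, mul_div_assoc, Finset.sum_div]
          congr 1
          refine Finset.sum_congr rfl fun i _ => ?_
          rw [← Finset.mul_sum, mul_div_assoc]
  calc boolVariance p ≤ boolAvg (fun x => (evalBool p x - Q.coeff 0) ^ 2) := boolVariance_le_boolAvg_sq_sub p _
    _ ≤ (1 / 3 : ℝ) * ∑ i ∈ Finset.range d, (4 : ℝ) ^ (i + 1) * Q.coeff (i + 1) ^ 2 *
          boolAvg (fun x => t x ^ (2 * (i + 1))) := hsumavg
    _ ≤ (1 / 3 : ℝ) * ∑ i ∈ Finset.range d, 4 * (96 * (d : ℝ) ^ 2 / N) ^ (i + 1) :=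
        mul_le_mul_of_nonneg_left (Finset.sum_le_sum hterm) (by norm_num)
    _ = (4 / 3 : ℝ) * ∑ i ∈ Finset.range d, (96 * (d : ℝ) ^ 2 / N) ^ (i + 1) := by
        rw [← Finset.mul_sum]; ring
    _ ≤ (4 / 3 : ℝ) * (2 * (96 * (d : ℝ) ^ 2 / N)) := mul_le_mul_of_nonneg_left (hgeom d) (by norm_num)
    _ = 256 * (d : ℝ) ^ 2 / N := by ring

/-- **`Var[p]·n ≤ 256 d²` for every `n`** (weight-symmetric `[0,1]`-bounded `p` of degree `≤ d`): the sharp bound when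
`n ≥ 192 d²`, and `Var ≤ 1/4` otherwise. [cite: Rivlin1974, Sect. 2.7 Remark 2 (2.44)-(2.45)] [cite: ODonnell2014, Thm. 9.21] -/
theorem boolVariance_mul_card_le_of_symmetric {d : ℕ} (p : MvPolynomial (Fin N) ℝ) (hdeg : p.totalDegree ≤ d)
    (hsym : ∀ x x' : Fin N → Bool,
      (Finset.univ.filter fun k => x k = true).card = (Finset.univ.filter fun k => x' k = true).card →
        evalBool p x = evalBool p x')
    (hb : ∀ x, 0 ≤ evalBool p x ∧ evalBool p x ≤ 1) (hN : 0 < N) :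
    boolVariance p * N ≤ 256 * (d : ℝ) ^ 2 := by
  have hN0 : (0 : ℝ) < (N : ℝ) := by exact_mod_cast hN
  by_cases hn : 192 * d ^ 2 ≤ N
  · have h := boolVariance_le_of_symmetric_sharp p hdeg hsym hb hn hN
    rwa [le_div_iff₀ hN0] at h
  · have hn' : (N : ℝ) < 192 * (d : ℝ) ^ 2 := by
      have : N < 192 * d ^ 2 := not_le.mp hn
      exact_mod_cast this
    have hV := boolVariance_le_quarter hb
    have hV0 := boolVariance_nonneg p
    nlinarith

/-- **Aaronson–Ambainis on the symmetric corner, sharp exponent.**  A `[0,1]`-bounded weight-symmetric real polynomial of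
total degree `≤ d` on `{0,1}^n` with positive variance has a variable of influence `≥ Var[p]²/(64 d²)`
(`Var·n ≤ 256 d²` and `maxInf ≥ 4 Var/n`).  Both exponents are attained on this corner (Chebyshev profiles `d ≍ √n`;
`p = |x|/n`). [cite: AaronsonAmbainis2014, Conj. 6] [cite: Rivlin1974, Sect. 2.7 Remark 2 (2.44)-(2.45)]
[cite: ODonnell2014, Thm. 9.21] -/
theorem exists_influence_ge_of_symmetric_sharp {d : ℕ} (p : MvPolynomial (Fin N) ℝ) (hdeg : p.totalDegree ≤ d)
    (hsym : ∀ x x' : Fin N → Bool,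
      (Finset.univ.filter fun k => x k = true).card = (Finset.univ.filter fun k => x' k = true).card →
        evalBool p x = evalBool p x')
    (hb : ∀ x, 0 ≤ evalBool p x ∧ evalBool p x ≤ 1) (hv : 0 < boolVariance p) :
    ∃ i : Fin N, boolVariance p ^ 2 / (64 * (d : ℝ) ^ 2) ≤ influence i p := by
  -- `N ≥ 1`: otherwise the variance vanishes
  have hN : 0 < N := by
    rcases Nat.eq_zero_or_pos N with h0 | hpos
    · exfalso
      subst h0
      have : boolVariance p = 0 := by
        unfold boolVariance boolAvg
        simp
      linarith
    · exact hpos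
  have hN0 : (0 : ℝ) < (N : ℝ) := by exact_mod_cast hN
  obtain ⟨i, hi⟩ := exists_influence_ge_avg hN p
  refine ⟨i, le_trans ?_ hi⟩
  have hVN := boolVariance_mul_card_le_of_symmetric p hdeg hsym hb hN
  rcases Nat.eq_zero_or_pos d with hd0 | hdpos
  · subst hd0
    simp only [Nat.cast_zero, ne_eq, OfNat.ofNat_ne_zero, not_false_eq_true, zero_pow, mul_zero, div_zero]
    positivity
  have hd0 : (0 : ℝ) < (d : ℝ) := by exact_mod_cast hdpos
  rw [div_le_div_iff₀ (by positivity) hN0]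
  calc boolVariance p ^ 2 * N = boolVariance p * (boolVariance p * N) := by ring
    _ ≤ boolVariance p * (256 * (d : ℝ) ^ 2) := mul_le_mul_of_nonneg_left hVN hv.le
    _ = 4 * boolVariance p * (64 * (d : ℝ) ^ 2) := by ring

/-- **The statement of the route decl `AAConj` on the symmetric corner, sharp shape `(c, C) = (2, 1/64)`**: for all
`N, d`, every `[0,1]`-bounded weight-symmetric `p` of total degree `≤ d` and every `0 < ε ≤ Var[p]`, some variable has
`(1/64)·(ε/d)² ≤ Inf_i[p]`. [cite: AaronsonAmbainis2014, Conj. 6] -/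
theorem aaConj_symmetricCorner_sharp (N d : ℕ) (p : MvPolynomial (Fin N) ℝ) (ε : ℝ)
    (hsym : ∀ x x' : Fin N → Bool,
      (Finset.univ.filter fun k => x k = true).card = (Finset.univ.filter fun k => x' k = true).card →
        evalBool p x = evalBool p x')
    (hdeg : p.totalDegree ≤ d) (hb : ∀ x, 0 ≤ evalBool p x ∧ evalBool p x ≤ 1)
    (hε : 0 < ε) (hεV : ε ≤ boolVariance p) :
    ∃ i : Fin N, (1 / 64 : ℝ) * (ε / d) ^ 2 ≤ influence i p := by
  obtain ⟨i, hi⟩ := exists_influence_ge_of_symmetric_sharp p hdeg hsym hb (lt_of_lt_of_le hε hεV)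
  refine ⟨i, le_trans ?_ hi⟩
  rw [div_pow, show (1 / 64 : ℝ) * (ε ^ 2 / (d : ℝ) ^ 2) = ε ^ 2 / (64 * (d : ℝ) ^ 2) by ring]
  exact div_le_div_of_nonneg_right (pow_le_pow_left₀ hε.le hεV 2) (by positivity)

/-- **The statement of the route decl `SosSandwich.PseudoBoundedAA` (stmt-QuantumAdvantage-15237) on the symmetric
corner, sharp shape `(c, C) = (2, 1/256)`**: a pseudo-bounded `p` of order `T` (hence of degree `≤ 2T` on the cube) that
is weight-symmetric, with `0 < ε ≤ Var[p]`, has a variable with `(1/256)(ε/T)² ≤ Inf_i[p]` — the card's sharp prediction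
`(c, exponent of T) = (2, 2)`, met on the symmetric corner. [cite: AaronsonAmbainis2014, Conj. 6]
[cite: KaniewskiLeeDewolf2015, Def. 7] -/
theorem pseudoBoundedAA_symmetricCorner_sharp (N T : ℕ) (p : MvPolynomial (Fin N) ℝ) (ε : ℝ)
    (hsym : ∀ x x' : Fin N → Bool,
      (Finset.univ.filter fun k => x k = true).card = (Finset.univ.filter fun k => x' k = true).card →
        evalBool p x = evalBool p x')
    (hpb : PseudoBounded T p) (hε : 0 < ε) (hεV : ε ≤ boolVariance p) :
    ∃ i : Fin N, (1 / 256 : ℝ) * (ε / T) ^ 2 ≤ influence i p := by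
  -- a representing polynomial of total degree `≤ 2T` with the same cube values
  obtain ⟨m, q, r, hqr, hval⟩ := hpb
  set P : MvPolynomial (Fin N) ℝ := ∑ j, q j ^ 2 with hP
  have hPdeg : P.totalDegree ≤ 2 * T := by
    refine (MvPolynomial.totalDegree_finsetSum _ _).trans (Finset.sup_le fun j _ => ?_)
    calc (q j ^ 2).totalDegree ≤ 2 * (q j).totalDegree := MvPolynomial.totalDegree_pow _ _
      _ ≤ 2 * T := Nat.mul_le_mul_left 2 (hqr j).1
  have hPval : ∀ x, evalBool P x = evalBool p x := by
    intro x
    unfold evalBool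
    rw [hP, map_sum]
    have h1 := (hval x).1
    change evalBool p x = ∑ j, evalBool (q j) x ^ 2 at h1
    unfold evalBool at h1
    rw [h1]
    exact Finset.sum_congr rfl fun j _ => by rw [map_pow]
  have hb : ∀ x, 0 ≤ evalBool p x ∧ evalBool p x ≤ 1 := by
    intro x
    have h1 := (hval x).1
    have h2 := (hval x).2
    change evalBool p x = ∑ j, evalBool (q j) x ^ 2 at h1
    change 1 - evalBool p x = ∑ j, evalBool (r j) x ^ 2 at h2
    constructor
    · rw [h1]; exact Finset.sum_nonneg fun j _ => sq_nonneg _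
    · have : 0 ≤ ∑ j, evalBool (r j) x ^ 2 := Finset.sum_nonneg fun j _ => sq_nonneg _
      linarith
  -- transfer variance / influences / symmetry / bounds to `P`
  have hfun : evalBool P = evalBool p := funext hPval
  have hVP : boolVariance P = boolVariance p := by unfold boolVariance; rw [hfun]
  have hIP : ∀ i, influence i P = influence i p := by intro i; unfold influence; rw [hfun]
  have hsymP : ∀ x x' : Fin N → Bool,
      (Finset.univ.filter fun k => x k = true).card = (Finset.univ.filter fun k => x' k = true).card →
        evalBool P x = evalBool P x' := by
    intro x x' h; rw [hPval, hPval]; exact hsym x x' h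
  have hbP : ∀ x, 0 ≤ evalBool P x ∧ evalBool P x ≤ 1 := by intro x; rw [hPval]; exact hb x
  have hεVP : ε ≤ boolVariance P := by rw [hVP]; exact hεV
  obtain ⟨i, hi⟩ := aaConj_symmetricCorner_sharp N (2 * T) P ε hsymP hPdeg hbP hε hεVP
  refine ⟨i, ?_⟩
  rw [hIP] at hi
  refine le_trans (le_of_eq ?_) hi
  push_cast
  ring

end Summit.QuantumAdvantage.QuantumAdvantage.Theorems.SosSandwich.SymmetricCorner

end
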